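import Summits.AtomisticToContinuum.HydrodynamicLimit.Theorems.CollisionIsometryCLTAdaptedWeightCLTCBEqRungStatics

/-!
# Equilibrium rung of the crux `AdaptedWeightCLT` (stmt-AtomisticToContinuum-14868), line `Sketch`:
# the static block-anisotropy bound under the local Gibbs law at constant profiles

Support file (`--supports stmt-AtomisticToContinuum-14868`, anchor `eqRung_statics_anchor`) of the line lead
`prover-line-stmt-AtomisticToContinuum-14868-c3-0`; fourth file of the EQUILIBRIUM RUNG. MAIN RESULT
(`exists_lintegral_anisC_le`): for `0 < θ` there is a finite `K = K(u, θ)` such that for every `N`, `a ≥ 0`,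
`σ` (local Gibbs law normalisable), every flow `Φ`, every continuous kernel `0 ≤ φ_N ≤ w_max` and every
density cap `Dcap` of the kernel on the hard-sphere domain,

  `E_{G_N} anis ≤ K (Dcap + 1)² (w_max/(N+1))^{1/4}`,   `G_N = localGibbsLaw σ a u θ N Φ`,

where `anis(z) = ∫ₓ Σ_{jk} D_{jk}(z,x)² + |q(z,x)|² dx` is the crux's block anisotropy. With the admissible
kernel bounds `w_max = C(N+1)^{3γ}` and the density cap `27C/σ³` (`TimeZero.density_cap`) the right side is
`O((N+1)^{(3γ−1)/4}) → 0`: the block traceless kinetic stress and the block kinetic heat flux of a LOCAL GIBBS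
STATE vanish in `L²(G_N; L²ₓ)`. Proof: per block centre `x` and positions `p`, the velocity expectation under
`⊗ N(u, θ𝟙)` is bounded by `…CBEqRungStatics` (`lintegral_blkC_sq_zip_le` for the nine rank-2 and the three
rank-3 tests, `core_shape_real_le`, `cap_bookkeeping`); then the disintegration of the local Gibbs law into the
position marginal (mass one, `lintegral_posWeight_eq_one`) and Gaussian velocities
(`lintegral_localGibbsMeasure`), and Tonelli in `(z, x)`. No position law of large numbers is used: `D` and `q`
are velocity FLUCTUATIONS given the positions. No definitions are introduced (pure proof file).

References: H. Spohn, *Large Scale Dynamics of Interacting Particles* (1991), Part I §2.3 [Spohn1991].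
-/

namespace Summit.AtomisticToContinuum.HydrodynamicLimit.Theorems.ContactBalance

open scoped BigOperators Topology Classical MeasureTheory ENNReal InnerProductSpace
open Filter Set MeasureTheory ProbabilityTheory
open Literature.Analysis.FluidPDE
open Summit.AtomisticToContinuum.HydrodynamicLimit.Theorems.ContactSourceDuhamel
open Summit.AtomisticToContinuum.HydrodynamicLimit.Theorems.ContactSourceDuhamel.TimeLocal
open Literature.MathematicalPhysics.KineticTheory (gaussMeasure hsDiameter localGibbsLaw localGibbsLaw_eq
  localGibbsMeasure lintegral_localGibbsMeasure lintegral_posWeight_eq_one zipConfig zipConfig_apply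
  posWeight posDomain zipConfig_mem_hardSphereDomain_iff measurable_posWeight localGibbsProfile)

noncomputable section

namespace EqRung

/-! ## The static expectation of the block defect at fixed positions and block -/

section Defect

variable (u : V3) {θ : ℝ}

/-- Measurability of the squared block moments in the velocities, at fixed positions and block. -/
theorem measurable_blkC_zip_sq {N : ℕ} (φ : ℕ → T3 → ℝ) (p : Fin (N + 1) → T3) (x : T3) {r : ℕ} (C' : Tens r) :
    Measurable fun v : Fin (N + 1) → V3 => ENNReal.ofReal (blkC r N φ (zipConfig (p, v)) x C' ^ 2) := by
  have hub : Measurable fun v : Fin (N + 1) → V3 => ubarC N φ (zipConfig (p, v)) x := by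
    have e : (fun v : Fin (N + 1) → V3 => ubarC N φ (zipConfig (p, v)) x) =
        fun v => (∑ i, φ N (p i - x))⁻¹ • ∑ i, φ N (p i - x) • v i := by
      funext v
      rw [Pointwise.ubarC_eq]
      simp [wgtC_zipConfig, zipConfig_apply]
    rw [e]
    exact Continuous.measurable (by fun_prop)
  have hmb : Measurable fun v : Fin (N + 1) → V3 => blkC r N φ (zipConfig (p, v)) x C' := by
    unfold blkC
    simp_rw [wgtC_zipConfig]
    simp only [zipConfig_apply]
    refine (Finset.measurable_sum _ fun i _ => ?_).const_mul _
    exact measurable_const.mul ((continuous_pairT_tpow C').measurable.comp ((measurable_pi_apply i).sub hub))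
  exact (hmb.pow_const 2).ennreal_ofReal

/-- **Static bound at fixed positions and block.** For `0 < θ` there is a finite constant `K` (depending on
`u, θ` only) such that for every `N`, kernel `φ_N ≥ 0`, positions `p` and block centre `x`, with
`W = Σ φ_N(pᵢ − x)` and `s = Σ (φ_N(pᵢ − x)/W)²`:
`E_{⊗N(u,θ𝟙)} defect(zipConfig (p, ·), x) ≤ K · (W/(N+1))² · s^{1/4}`. -/
theorem exists_lintegral_defectC_zip_le (hθ : 0 < θ) :
    ∃ K : ℝ≥0∞, K ≠ ⊤ ∧ ∀ (N : ℕ) (φ : ℕ → T3 → ℝ), (∀ y, 0 ≤ φ N y) →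
      ∀ (p : Fin (N + 1) → T3) (x : T3),
        ∫⁻ v, ENNReal.ofReal (defectC N φ (zipConfig (p, v)) x) ∂(Measure.pi fun _ : Fin (N + 1) => gaussMeasure u θ) ≤
          K * (ENNReal.ofReal (((∑ j, φ N (p j - x)) / ((N + 1 : ℕ) : ℝ)) ^ 2) *
            ENNReal.ofReal (∑ i, (φ N (p i - x) / ∑ j, φ N (p j - x)) ^ 2) ^ (1 / 4 : ℝ)) := by
  -- the shape constants (rank 2: degree `k + 1 = 2`; rank 3: `k + 1 = 3`)
  set Kf : ℕ → ℝ≥0∞ := fun k =>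
    2 * ENNReal.ofReal (4 * ∫ w, ‖w - u‖ ^ (2 * (k + 1)) ∂gaussMeasure u θ) +
      2 * ENNReal.ofReal (16 * 9 ^ k) * ENNReal.ofReal (3 * θ) ^ (1 / 4 : ℝ) *
        ENNReal.ofReal (∫ w, ‖w - u‖ ^ 6 ∂gaussMeasure u θ) ^ (1 / 4 : ℝ) *
          ENNReal.ofReal (∫ w, ‖w - u‖ ^ (k * 4) ∂gaussMeasure u θ) ^ (1 / 2 : ℝ) with hKf
  have hrt : ∀ (y : ℝ≥0∞) (e : ℝ), y ≠ ⊤ → 0 ≤ e → y ^ e ≠ ⊤ := fun y e hy he =>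
    ENNReal.rpow_ne_top_of_nonneg he hy
  have hKft : ∀ k, Kf k ≠ ⊤ := by
    intro k
    refine ENNReal.add_ne_top.2 ⟨ENNReal.mul_ne_top (by norm_num) ENNReal.ofReal_ne_top, ?_⟩
    exact ENNReal.mul_ne_top (ENNReal.mul_ne_top (ENNReal.mul_ne_top (ENNReal.mul_ne_top (by norm_num)
      ENNReal.ofReal_ne_top) (hrt _ _ ENNReal.ofReal_ne_top (by norm_num)))
      (hrt _ _ ENNReal.ofReal_ne_top (by norm_num))) (hrt _ _ ENNReal.ofReal_ne_top (by norm_num))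
  refine ⟨9 * Kf 1 + 3 * Kf 2, ENNReal.add_ne_top.2 ⟨ENNReal.mul_ne_top (by norm_num) (hKft 1),
    ENNReal.mul_ne_top (by norm_num) (hKft 2)⟩, fun N φ hφ0 p x => ?_⟩
  set W : ℝ := ∑ j, φ N (p j - x) with hWdef
  set s : ℝ := ∑ i, (φ N (p i - x) / ∑ j, φ N (p j - x)) ^ 2 with hsdef
  -- `s ≤ 1`
  have hs1 : s ≤ 1 := by
    by_cases hW : ∑ j, φ N (p j - x) = 0
    · have h0 : ∀ i, φ N (p i - x) = 0 := fun i =>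
        (Finset.sum_eq_zero_iff_of_nonneg fun j _ => hφ0 (p j - x)).1 hW i (Finset.mem_univ i)
      simp [hsdef, h0]
    · exact (ratios_props (w := fun i => φ N (p i - x)) (fun i => hφ0 _) hW (wcap := ∑ j, φ N (p j - x))
        (fun i => Finset.single_le_sum (fun j _ => hφ0 (p j - x)) (Finset.mem_univ i))).2.2.1
  -- per-test bounds
  have h2 : ∀ j l : Fin 3, ∫⁻ v, ENNReal.ofReal (blkC 2 N φ (zipConfig (p, v)) x (C2 j l) ^ 2)
      ∂(Measure.pi fun _ : Fin (N + 1) => gaussMeasure u θ) ≤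
      ENNReal.ofReal ((W / ((N + 1 : ℕ) : ℝ)) ^ 2) * (Kf 1 * ENNReal.ofReal s ^ (1 / 4 : ℝ)) := by
    intro j l
    have hf0 : ∀ y : V3, |pairT (C2 j l) (tpow 2 y)| ≤ 2 * ‖y‖ ^ (1 + 1) := fun y => by
      simpa using Pointwise.abs_pairT_C2_le j l y
    have hf1 : ∀ y y' : V3, |pairT (C2 j l) (tpow 2 y') - pairT (C2 j l) (tpow 2 y)| ≤
        2 * ‖y' - y‖ * (‖y'‖ + ‖y‖) ^ 1 := fun y y' => by
      simpa using Pointwise.abs_pairT_C2_sub_le j l y y'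
    exact (lintegral_blkC_sq_zip_le u hθ (C2 j l) (k := 1) hf0 hf1 (integral_pairT_C2_sub u hθ j l) hφ0 p x).trans
      (mul_le_mul_right (core_shape_real_le u hθ 1 hs1) _)
  have h3 : ∀ a : Fin 3, ∫⁻ v, ENNReal.ofReal (blkC 3 N φ (zipConfig (p, v)) x (C3 a) ^ 2)
      ∂(Measure.pi fun _ : Fin (N + 1) => gaussMeasure u θ) ≤
      ENNReal.ofReal ((W / ((N + 1 : ℕ) : ℝ)) ^ 2) * (Kf 2 * ENNReal.ofReal s ^ (1 / 4 : ℝ)) := by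
    intro a
    have hf0 : ∀ y : V3, |pairT (C3 a) (tpow 3 y)| ≤ 2 * ‖y‖ ^ (2 + 1) := fun y => by
      have h := Pointwise.abs_pairT_C3_le a y
      have h3 : (0 : ℝ) ≤ ‖y‖ ^ 3 := pow_nonneg (norm_nonneg y) 3
      norm_num
      linarith
    have hf1 : ∀ y y' : V3, |pairT (C3 a) (tpow 3 y') - pairT (C3 a) (tpow 3 y)| ≤
        2 * ‖y' - y‖ * (‖y'‖ + ‖y‖) ^ 2 := fun y y' => by
      have h := Pointwise.abs_pairT_C3_sub_le a y y'
      have h0 : (0 : ℝ) ≤ ‖y' - y‖ * (‖y'‖ + ‖y‖) ^ 2 := by positivity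
      linarith
    exact (lintegral_blkC_sq_zip_le u hθ (C3 a) (k := 2) hf0 hf1 (integral_pairT_C3_sub u hθ a) hφ0 p x).trans
      (mul_le_mul_right (core_shape_real_le u hθ 2 hs1) _)
  -- sum over the tests
  have hmeas : ∀ {r : ℕ} (C' : Tens r), Measurable fun v : Fin (N + 1) → V3 =>
      ENNReal.ofReal (blkC r N φ (zipConfig (p, v)) x C' ^ 2) := fun C' => measurable_blkC_zip_sq φ p x C'
  have hsplit : ∀ v : Fin (N + 1) → V3, ENNReal.ofReal (defectC N φ (zipConfig (p, v)) x) =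
      (∑ j, ∑ l, ENNReal.ofReal (blkC 2 N φ (zipConfig (p, v)) x (C2 j l) ^ 2)) +
        ∑ a, ENNReal.ofReal (blkC 3 N φ (zipConfig (p, v)) x (C3 a) ^ 2) := by
    intro v
    unfold defectC
    rw [ENNReal.ofReal_add (Finset.sum_nonneg fun _ _ => Finset.sum_nonneg fun _ _ => sq_nonneg _)
      (Finset.sum_nonneg fun _ _ => sq_nonneg _),
      ENNReal.ofReal_sum_of_nonneg fun _ _ => Finset.sum_nonneg fun _ _ => sq_nonneg _,
      ENNReal.ofReal_sum_of_nonneg fun _ _ => sq_nonneg _]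
    congr 1
    exact Finset.sum_congr rfl fun j _ => ENNReal.ofReal_sum_of_nonneg fun _ _ => sq_nonneg _
  have htot : ∫⁻ v, ENNReal.ofReal (defectC N φ (zipConfig (p, v)) x) ∂(Measure.pi fun _ : Fin (N + 1) => gaussMeasure u θ) =
      (∑ j, ∑ l, ∫⁻ v, ENNReal.ofReal (blkC 2 N φ (zipConfig (p, v)) x (C2 j l) ^ 2)
          ∂(Measure.pi fun _ : Fin (N + 1) => gaussMeasure u θ)) +
        ∑ a, ∫⁻ v, ENNReal.ofReal (blkC 3 N φ (zipConfig (p, v)) x (C3 a) ^ 2)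
          ∂(Measure.pi fun _ : Fin (N + 1) => gaussMeasure u θ) := by
    simp_rw [hsplit]
    rw [lintegral_add_left (Finset.measurable_sum _ fun j _ => Finset.measurable_sum _ fun l _ => hmeas (C2 j l)),
      lintegral_finsetSum _ fun j _ => Finset.measurable_sum _ fun l _ => hmeas (C2 j l),
      lintegral_finsetSum _ fun a _ => hmeas (C3 a)]
    congr 1
    exact Finset.sum_congr rfl fun j _ => lintegral_finsetSum _ fun l _ => hmeas (C2 j l)
  rw [htot]
  calc (∑ j : Fin 3, ∑ l : Fin 3, ∫⁻ v, ENNReal.ofReal (blkC 2 N φ (zipConfig (p, v)) x (C2 j l) ^ 2)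
          ∂(Measure.pi fun _ : Fin (N + 1) => gaussMeasure u θ)) +
        ∑ a : Fin 3, ∫⁻ v, ENNReal.ofReal (blkC 3 N φ (zipConfig (p, v)) x (C3 a) ^ 2)
          ∂(Measure.pi fun _ : Fin (N + 1) => gaussMeasure u θ)
      ≤ (∑ _j : Fin 3, ∑ _l : Fin 3, ENNReal.ofReal ((W / ((N + 1 : ℕ) : ℝ)) ^ 2) * (Kf 1 * ENNReal.ofReal s ^ (1 / 4 : ℝ))) +
          ∑ _a : Fin 3, ENNReal.ofReal ((W / ((N + 1 : ℕ) : ℝ)) ^ 2) * (Kf 2 * ENNReal.ofReal s ^ (1 / 4 : ℝ)) :=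
        add_le_add (Finset.sum_le_sum fun j _ => Finset.sum_le_sum fun l _ => h2 j l)
          (Finset.sum_le_sum fun a _ => h3 a)
    _ = (9 * Kf 1 + 3 * Kf 2) * (ENNReal.ofReal ((W / ((N + 1 : ℕ) : ℝ)) ^ 2) * ENNReal.ofReal s ^ (1 / 4 : ℝ)) := by
        simp only [Finset.sum_const, Finset.card_univ, Fintype.card_fin, nsmul_eq_mul, Nat.cast_ofNat]
        ring

end Defect

/-! ## Integration over the block centre and the position marginal of the local Gibbs law -/

section Gibbs

variable (u : V3) {θ : ℝ}

/-- **Static expectation bound for the block anisotropy under the local Gibbs law at constant profiles.**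
For `0 < θ` there is a finite `K = K(u, θ)` such that for every `N`, every `a ≥ 0`, every `σ` with the local
Gibbs law a probability measure, every flow `Φ`, every continuous kernel `0 ≤ φ_N ≤ wcap` and every density
cap `Dcap` (`(N+1)⁻¹ Σᵢ φ_N(xᵢ − x) ≤ Dcap` on the hard-sphere domain):
`E_{G_N} anis ≤ K (Dcap + 1)² (wcap/(N+1))^{1/4}`. -/
theorem exists_lintegral_anisC_le (hθ : 0 < θ) :
    ∃ K : ℝ≥0∞, K ≠ ⊤ ∧ ∀ (N : ℕ) (a σ : ℝ) (Φ : Flow σ N) (φ : ℕ → T3 → ℝ), 0 ≤ a → Continuous (φ N) →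
      (∀ y, 0 ≤ φ N y) → ∀ (wcap : ℝ), 0 ≤ wcap → (∀ y, φ N y ≤ wcap) → ∀ (Dcap : ℝ),
        (∀ z ∈ hardSphereDomain (Torus.geometry (Fin 3)) (N + 1) (hsDiameter σ N), ∀ x : T3,
          ((N + 1 : ℕ) : ℝ)⁻¹ * ∑ i, wgtC N φ z x i ≤ Dcap) →
        IsProbabilityMeasure (localGibbsMeasure σ (fun _ => a) (fun _ => u) (fun _ => θ) N) →
          ∫⁻ z, ENNReal.ofReal (anisC N φ z) ∂(localGibbsLaw σ (fun _ => a) (fun _ => u) (fun _ => θ) N Φ) ≤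
            K * ENNReal.ofReal ((Dcap + 1) ^ 2 * (wcap / ((N + 1 : ℕ) : ℝ)) ^ (1 / 4 : ℝ)) := by
  obtain ⟨K, hK, hbound⟩ := exists_lintegral_defectC_zip_le u hθ
  refine ⟨K, hK, fun N a σ Φ φ ha0 hφc hφ0 wcap hwcap hφw Dcap hcap hprob => ?_⟩
  haveI := hprob
  set M : ℝ := ((N + 1 : ℕ) : ℝ) with hMdef
  have hM : 0 < M := by rw [hMdef]; positivity
  set R : ℝ≥0∞ := K * ENNReal.ofReal ((Dcap + 1) ^ 2 * (wcap / M) ^ (1 / 4 : ℝ)) with hRdef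
  have hca : Continuous (fun _ : T3 => a) := continuous_const
  have hcθ : Continuous (fun _ : T3 => θ) := continuous_const
  have hcu : Continuous (fun _ : T3 => u) := continuous_const
  -- Step 1: per block centre `x` and admissible positions `p`, the velocity expectation is `≤ R`
  have hfix : ∀ (x : T3) (p : Fin (N + 1) → T3), p ∈ posDomain (hsDiameter σ N) (N + 1) →
      ∫⁻ v, ENNReal.ofReal (defectC N φ (zipConfig (p, v)) x)
        ∂(Measure.pi fun _ : Fin (N + 1) => gaussMeasure u θ) ≤ R := by
    intro x p hp
    refine (hbound N φ hφ0 p x).trans (mul_le_mul_right ?_ _)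
    by_cases hW : ∑ j, φ N (p j - x) = 0
    · have h0 : ∀ i, φ N (p i - x) = 0 := fun i =>
        (Finset.sum_eq_zero_iff_of_nonneg fun j _ => hφ0 (p j - x)).1 hW i (Finset.mem_univ i)
      simp [h0]
    · have hWpos : 0 < ∑ j, φ N (p j - x) :=
        lt_of_le_of_ne (Finset.sum_nonneg fun j _ => hφ0 _) (Ne.symm hW)
      obtain ⟨-, -, -, hsw⟩ := ratios_props (w := fun i => φ N (p i - x)) (fun i => hφ0 _) hW (fun i => hφw _)
      have hs0 : (0 : ℝ) ≤ ∑ i, (φ N (p i - x) / ∑ j, φ N (p j - x)) ^ 2 :=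
        Finset.sum_nonneg fun i _ => sq_nonneg _
      -- density cap at the zipped configuration `(p, 0)`
      have hcapW : (∑ j, φ N (p j - x)) / M ≤ Dcap := by
        have hz : zipConfig (p, (0 : Fin (N + 1) → V3)) ∈
            hardSphereDomain (Torus.geometry (Fin 3)) (N + 1) (hsDiameter σ N) :=
          (zipConfig_mem_hardSphereDomain_iff (hsDiameter σ N) p 0).2 hp
        have h := hcap _ hz x
        simp_rw [wgtC_zipConfig] at h
        rwa [div_eq_inv_mul]
      rw [ENNReal.ofReal_rpow_of_nonneg hs0 (by norm_num), ← ENNReal.ofReal_mul (sq_nonneg _)]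
      exact ENNReal.ofReal_le_ofReal (cap_bookkeeping hM hWpos hcapW hwcap hs0 hsw)
  -- Step 2: disintegrate the local Gibbs law at a fixed block centre `x`
  rw [localGibbsLaw_eq]
  have hZm : Measurable fun q : Fin (N + 1) → T3 => ENNReal.ofReal
      ((canonicalPartition (Torus.geometry (Fin 3)) (hsDiameter σ N) (N + 1)
        (localGibbsProfile (fun _ => a) (fun _ => u) (fun _ => θ)))⁻¹ *
          posWeight (fun _ => a) (hsDiameter σ N) (N + 1) q) :=
    ((measurable_posWeight hca _ _).const_mul _).ennreal_ofReal
  have hx : ∀ x : T3, ∫⁻ z, ENNReal.ofReal (defectC N φ z x)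
      ∂(localGibbsMeasure σ (fun _ => a) (fun _ => u) (fun _ => θ) N) ≤ R := by
    intro x
    have hG : Measurable fun z : Cfg N => ENNReal.ofReal (defectC N φ z x) :=
      ((measurable_defectC_prod hφc).comp (measurable_id.prodMk measurable_const)).ennreal_ofReal
    rw [lintegral_localGibbsMeasure hca hcθ hcu (fun _ => ha0) (fun _ => hθ) σ N hG]
    calc _ ≤ ∫⁻ q : Fin (N + 1) → T3, ENNReal.ofReal
          ((canonicalPartition (Torus.geometry (Fin 3)) (hsDiameter σ N) (N + 1)
            (localGibbsProfile (fun _ => a) (fun _ => u) (fun _ => θ)))⁻¹ *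
              posWeight (fun _ => a) (hsDiameter σ N) (N + 1) q) * R := by
          refine lintegral_mono fun q => ?_
          by_cases hq : q ∈ posDomain (hsDiameter σ N) (N + 1)
          · exact mul_le_mul_right (hfix x q hq) _
          · have h0 : posWeight (fun _ : T3 => a) (hsDiameter σ N) (N + 1) q = 0 := by
              rw [posWeight, Set.indicator_of_notMem hq]
            rw [h0, mul_zero, ENNReal.ofReal_zero, zero_mul, zero_mul]
      _ = R := by
          rw [lintegral_mul_const _ hZm, lintegral_posWeight_eq_one hca hcθ hcu (fun _ => ha0) (fun _ => hθ) σ N,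
            one_mul]
  -- Step 3: the block anisotropy is the `x`-integral of the defect (Tonelli)
  have hswap : ∫⁻ z, (∫⁻ x, ENNReal.ofReal (defectC N φ z x) ∂(volume : Measure T3))
      ∂(localGibbsMeasure σ (fun _ => a) (fun _ => u) (fun _ => θ) N) =
      ∫⁻ x, (∫⁻ z, ENNReal.ofReal (defectC N φ z x)
        ∂(localGibbsMeasure σ (fun _ => a) (fun _ => u) (fun _ => θ) N)) ∂(volume : Measure T3) :=
    lintegral_lintegral_swap (measurable_defectC_prod hφc).ennreal_ofReal.aemeasurable
  -- the Bochner `x`-integral is below the lower integral (equality when integrable, junk `0` otherwise)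
  have hle : ∀ z : Cfg N, ENNReal.ofReal (anisC N φ z) ≤ ∫⁻ x, ENNReal.ofReal (defectC N φ z x) ∂(volume : Measure T3) := by
    intro z
    show ENNReal.ofReal (∫ x, defectC N φ z x) ≤ _
    by_cases hf : Integrable (fun x => defectC N φ z x) (volume : Measure T3)
    · rw [ofReal_integral_eq_lintegral_ofReal hf (ae_of_all _ fun x => FreeStretch.defectC_nonneg φ z x)]
    · rw [integral_undef hf]; simp
  calc ∫⁻ z, ENNReal.ofReal (anisC N φ z) ∂(localGibbsMeasure σ (fun _ => a) (fun _ => u) (fun _ => θ) N)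
      ≤ ∫⁻ z, (∫⁻ x, ENNReal.ofReal (defectC N φ z x) ∂(volume : Measure T3))
          ∂(localGibbsMeasure σ (fun _ => a) (fun _ => u) (fun _ => θ) N) := lintegral_mono hle
    _ = ∫⁻ x, (∫⁻ z, ENNReal.ofReal (defectC N φ z x)
          ∂(localGibbsMeasure σ (fun _ => a) (fun _ => u) (fun _ => θ) N)) ∂(volume : Measure T3) := hswap
    _ ≤ ∫⁻ _x : T3, R := lintegral_mono fun x => hx x
    _ = R := by rw [lintegral_const, measure_univ, mul_one]

end Gibbs

/-! ## Registered anchor of this support file -/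

/-- ANCHOR (registered helper stub `eqRung_statics_anchor` of the crux item): at a zipped configuration
whose block at `x` is empty (all kernel weights vanish) every block moment vanishes — the degenerate case of
the static bound. -/
theorem eqRung_statics_anchor : ∀ (N r : ℕ) (φ : ℕ → T3 → ℝ) (p : Fin (N + 1) → T3) (x : T3) (C' : Tens r) (v : Fin (N + 1) → V3), (∀ i, φ N (p i - x) = 0) → blkC r N φ (Literature.MathematicalPhysics.KineticTheory.zipConfig (p, v)) x C' = 0 :=
  fun _ _ φ p x C' v h0 => blkC_zipConfig_eq_zero φ p x C' v h0

end EqRung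

end

end Summit.AtomisticToContinuum.HydrodynamicLimit.Theorems.ContactBalance
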